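import Summits.BirchSwinnertonDyer.BirchSwinnertonDyer.Theorems.ShaPrimaryTransferFiniteShaComponentTransferZywinaEqualityDoor
import Summits.BirchSwinnertonDyer.Rank2.RegulatorDoor
import Summits.BirchSwinnertonDyer.BirchSwinnertonDyer.Theorems.ShaPrimaryTransferFiniteShaComponentTransferZywinaEqualityDoorInfinite
import HarnessLib

/-!
# BirchSwinnertonDyer / ShaPrimaryTransfer — crux `FiniteShaComponentTransfer` (stmt-BirchSwinnertonDyer-22356):
# the `5`-adic equality door on the RESIDUE CLASSES `zywinaClass 5 K m₁ M` (R* discharges Schneider)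

Companion of `…ZywinaEqualityDoor` (member form of the door, with Schneider's conjecture at `5` as the
hypothesis `hReg`) and of the cell file `Summits/BirchSwinnertonDyer/Rank2/RegulatorDoor.lean` (THEOREM R*:
`Rank2.schneiderConjecture_of_mem_zywinaClass` — Schneider's conjecture at `p ≥ 5` for every member of
`zywinaClass p K m₁ M`, `K ≥ 1`, `p ∤ m₁`, `p^K ∤ m₁^{p−1} − 1`). Composing the two (cell `bsd-rank2`, seat p2):

* `equalityDoor_five_of_mem_zywinaClass` — on `zywinaClass 5 K m₁ M` with `7 ∣ M`, granting ONLY the prints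
  `Schneider1985_order_charGenerator` and `burungale_castella_skinner_charIdeal_eq_padicLFunction`:
  **`ord_{T=0} L_5(E_{m,n},T) = 2 ⟺ Ш(E_{m,n})[5^∞]` finite `⟺ t_5(E_{m,n}) = 0`** — every other input (rank `2`,
  good ordinary `5`, `E[5]` irreducible, Schneider at `5`) is a tree theorem on the class.
* `infinite_setOf_j_rankTwo_equalityDoor_at_five` — modulo Tao–Ziegler (`zywinaClass_infinite`), infinitely many
  `ℚ̄`-isomorphism classes of rank-2 curves carry the door in this exact form (class `zywinaClass 5 2 11 7`).
* `order_eq_two_of_transfer_of_mem_zywinaClass`, `transfer_instance_iff_order_eq_two_of_mem_zywinaClass` — T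
  (`FiniteShaComponentTransfer`) PREDICTS `ord_{T=0} L_5 = 2` on the whole class, and its instance `(E_{m,n}, 2, 5)`
  is EQUIVALENT to that statement, granting the two prints only.

PARTITION: r_an ≥ 2 side; S0 not touched (B1 honesty). References: as in `…ZywinaEqualityDoor`; T. Tao,
T. Ziegler, Acta Math. 201 (2008) Thm. 1.3; D. Zywina, arXiv:2502.01957 Thm. 1.2.
-/

-- D-0017: single-problem summit, so `Summit.BirchSwinnertonDyer.BirchSwinnertonDyer.…` repeats a namespace BY DESIGN.
set_option linter.dupNamespace false

noncomputable section

namespace Summit.BirchSwinnertonDyer.BirchSwinnertonDyer.Theorems.ShaPrimaryTransferZywinaEqualityDoorClasses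

open scoped Classical MatrixGroups ModularForm
open CongruenceSubgroup
open Literature.NumberTheory.EllipticCurves Literature.NumberTheory.EllipticCurves.Zywina2025
  Literature.NumberTheory.EllipticCurves.ModularForms
open Literature.NumberTheory.Sieve (TaoZiegler2008_polynomialProgressions)
open WeierstrassCurve
open Summit.BirchSwinnertonDyer.BirchSwinnertonDyer.Theses.ShaPrimaryTransfer (FiniteShaComponentTransfer)
open Summit.BirchSwinnertonDyer.BirchSwinnertonDyer.Theorems.ShaPrimaryTransferGoodOrdinaryFive
open Summit.BirchSwinnertonDyer.BirchSwinnertonDyer.Theorems.ShaPrimaryTransferZywinaEqualityDoor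

section Classes

variable {m n : ℕ}

/-- Membership in a class `zywinaClass p K m₁ M` with `7 ∣ M` gives `7 ∣ n`. [cite: Zywina2025, Thm 1.2 and §4] -/
theorem seven_dvd_of_mem_zywinaClass {p K m₁ M : ℕ} (h7M : 7 ∣ M) (hmn : (m, n) ∈ zywinaClass p K m₁ M) :
    7 ∣ n :=
  h7M.trans ((Dvd.intro_left _ rfl : M ∣ p ^ K * M).trans hmn.2.2)

/-- THEOREM R* on the class, in the shape of the door's hypothesis `hReg`. [cite: Schneider1982, §1 (p-adic height pairing and regulator)] -/
theorem schneiderConjecture_five_of_mem_zywinaClass [Fact (Nat.Prime 5)] {K m₁ M : ℕ} (hK : 0 < K)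
    (h5m₁ : ¬ 5 ∣ m₁) (hμ : ¬ (5 : ℤ) ^ K ∣ (m₁ : ℤ) ^ (5 - 1) - 1) (hmn : (m, n) ∈ zywinaClass 5 K m₁ M)
    [(zywinaCurve m n).IsElliptic] :
    ∀ D : PAdicHeightData (zywinaCurve m n) 5, D.IsCanonical → SchneiderConjecture D :=
  fun D hD ↦ Rank2.schneiderConjecture_of_mem_zywinaClass le_rfl hK h5m₁ hμ hmn D hD

/-! ## §1 The `5`-adic equality door on the residue classes of Zywina's family -/

/-- **THE `5`-ADIC EQUALITY DOOR ON ZYWINA'S CLASS.** Let `K ≥ 1`, `5 ∤ m₁`, `5^K ∤ m₁⁴ − 1`, `7 ∣ M`, and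
`(m, n) ∈ zywinaClass 5 K m₁ M` (admissible, `m ≡ m₁ (mod 5^K)`, `5^K M ∣ n`). Then — `rank E_{m,n}(ℚ) = 2`
(Zywina Thm. 1.2), `5` good ordinary (`goodOrdinary_five_zywinaCurve`), `E_{m,n}[5]` irreducible
(`hasIrreducibleModPGaloisRep_five_zywinaCurve`, `7 ∣ n`) and Schneider's conjecture at `5`
(`Rank2.schneiderConjecture_of_mem_zywinaClass`, THEOREM R*) being tree theorems — granting only the prints
`Schneider1985_order_charGenerator` and `burungale_castella_skinner_charIdeal_eq_padicLFunction`, for the newform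
`f` of `E_{m,n}`: **`ord_{T=0} L_5(E_{m,n}, T) = 2 ⟺ Ш(E_{m,n}/ℚ)[5^∞]` is finite.** The single non-print input
between the window `2 ≤ ord_{T=0} L_5` and `5`-adic BSD-rank on this class is `Ш[5^∞]`-finiteness, exactly.
CONDITIONAL on `h85`, `hMC`. [cite: BalakrishnanMullerStein2015, Thm. 1.7] [cite: BurungaleCastellaSkinner2025, Thm. 1.1.2 (a)]
[cite: Zywina2025, Thm 1.2] [cite: Mazur1978, §6 Prop. 6.3 (1)] -/
theorem equalityDoor_five_of_mem_zywinaClass [Fact (Nat.Prime 5)] (h85 : Schneider1985_order_charGenerator)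
    (hMC : burungale_castella_skinner_charIdeal_eq_padicLFunction) {K m₁ M : ℕ} (hK : 0 < K)
    (h5m₁ : ¬ 5 ∣ m₁) (hμ : ¬ (5 : ℤ) ^ K ∣ (m₁ : ℤ) ^ (5 - 1) - 1) (h7M : 7 ∣ M)
    (hmn : (m, n) ∈ zywinaClass 5 K m₁ M) [(zywinaCurve m n).IsElliptic] [(zywinaCurve m n).IsGloballyMinimal]
    {N : ℕ} [NeZero N] {f : CuspForm (Gamma0 N) 2} (hf : IsNewformOf (zywinaCurve m n) f) :
    (padicLFunction f (unitRoot (zywinaCurve m n) 5 : ℚ_[5])).order = 2 ↔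
      Finite (AddCommGroup.primaryComponent (zywinaCurve m n).sha 5) :=
  equalityDoor_five_zywinaCurve h85 hMC hmn.1 (seven_dvd_of_mem_zywinaClass h7M hmn)
    (schneiderConjecture_five_of_mem_zywinaClass hK h5m₁ hμ hmn) hf

/-- The door in corank form on the class: **`ord_{T=0} L_5(E_{m,n}, T) = 2 ⟺ t_5(E_{m,n}) = 0`**.
CONDITIONAL on `h85`, `hMC`. [cite: BalakrishnanMullerStein2015, Thm. 1.7] [cite: BurungaleCastellaSkinner2025, Thm. 1.1.2 (a)] -/
theorem equalityDoor_five_shaCorank_of_mem_zywinaClass [Fact (Nat.Prime 5)]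
    (h85 : Schneider1985_order_charGenerator) (hMC : burungale_castella_skinner_charIdeal_eq_padicLFunction)
    {K m₁ M : ℕ} (hK : 0 < K) (h5m₁ : ¬ 5 ∣ m₁) (hμ : ¬ (5 : ℤ) ^ K ∣ (m₁ : ℤ) ^ (5 - 1) - 1) (h7M : 7 ∣ M)
    (hmn : (m, n) ∈ zywinaClass 5 K m₁ M) [(zywinaCurve m n).IsElliptic] [(zywinaCurve m n).IsGloballyMinimal]
    {N : ℕ} [NeZero N] {f : CuspForm (Gamma0 N) 2} (hf : IsNewformOf (zywinaCurve m n) f) :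
    (padicLFunction f (unitRoot (zywinaCurve m n) 5 : ℚ_[5])).order = 2 ↔ (zywinaCurve m n).shaCorank 5 = 0 := by
  rw [equalityDoor_five_of_mem_zywinaClass h85 hMC hK h5m₁ hμ h7M hmn hf,
    finite_primaryComponent_sha_iff_shaCorank_eq_zero]

/-- **The window and the door together.** On the class, granting the two prints: `2 ≤ ord_{T=0} L_5(E_{m,n},T)`
always (no Kato: Schneider clause 1 through the main conjecture), with equality iff `Ш(E_{m,n})[5^∞]` is finite and
STRICT inequality iff it is infinite. CONDITIONAL on `h85`, `hMC`. [cite: BalakrishnanMullerStein2015, Thm. 1.7]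
[cite: BurungaleCastellaSkinner2025, Thm. 1.1.2 (a)] -/
theorem window_and_door_five_of_mem_zywinaClass [Fact (Nat.Prime 5)] (h85 : Schneider1985_order_charGenerator)
    (hMC : burungale_castella_skinner_charIdeal_eq_padicLFunction) {K m₁ M : ℕ} (hK : 0 < K)
    (h5m₁ : ¬ 5 ∣ m₁) (hμ : ¬ (5 : ℤ) ^ K ∣ (m₁ : ℤ) ^ (5 - 1) - 1) (h7M : 7 ∣ M)
    (hmn : (m, n) ∈ zywinaClass 5 K m₁ M) [(zywinaCurve m n).IsElliptic] [(zywinaCurve m n).IsGloballyMinimal]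
    {N : ℕ} [NeZero N] {f : CuspForm (Gamma0 N) 2} (hf : IsNewformOf (zywinaCurve m n) f) :
    (2 : ℕ∞) ≤ (padicLFunction f (unitRoot (zywinaCurve m n) 5 : ℚ_[5])).order ∧
      ((padicLFunction f (unitRoot (zywinaCurve m n) 5 : ℚ_[5])).order = 2 ↔
        Finite (AddCommGroup.primaryComponent (zywinaCurve m n).sha 5)) ∧
      ((2 : ℕ∞) < (padicLFunction f (unitRoot (zywinaCurve m n) 5 : ℚ_[5])).order ↔
        ¬ Finite (AddCommGroup.primaryComponent (zywinaCurve m n).sha 5)) := by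
  obtain ⟨hle, hrest⟩ := window_and_door_five_zywinaCurve h85 hMC hmn.1 (seven_dvd_of_mem_zywinaClass h7M hmn) hf
  exact ⟨hle, hrest (schneiderConjecture_five_of_mem_zywinaClass hK h5m₁ hμ hmn)⟩

/-! ## §2 Infinitely many isomorphism classes on which the door holds (modulo Tao–Ziegler) -/

section Infinite

/-- **The class `zywinaClass 5 2 11 7` is admissible for the door**: `K = 2`, `m₁ = 11` (`5 ∤ 11`,
`25 ∤ 11⁴ − 1 = 14640`), `M = 7`; it is infinite modulo Tao–Ziegler. [cite: Zywina2025, §4 (proof of Thm 1.1)] -/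
theorem zywinaClass_five_two_eleven_seven_infinite (hTZ : TaoZiegler2008_polynomialProgressions) :
    (zywinaClass 5 2 11 7).Infinite :=
  zywinaClass_infinite hTZ Nat.prime_five (by norm_num) (by norm_num) (by norm_num)

/-- **THE EQUALITY DOOR AT `5` ON AN INFINITE CLASS, counted by `j`-invariant.** Modulo Tao–Ziegler and the two
prints: the set of `j`-invariants of elliptic curves `E/ℚ` (global minimal model `W`) with `rank E(ℚ) = 2`, `5`
good ordinary, `E[5]` irreducible, and — for every newform `f` of `E` —
`ord_{T=0} L_5(f, α, T) = 2 ⟺ Ш(E/ℚ)[5^∞]` finite, is INFINITE (members of `zywinaClass 5 2 11 7`; distinct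
admissible pairs have distinct `j`, `eq_of_j_eq`). CONDITIONAL on `hTZ`, `h85`, `hMC`.
[cite: Zywina2025, Thm 1.1 and Lemma 4.1] [cite: BalakrishnanMullerStein2015, Thm. 1.7]
[cite: BurungaleCastellaSkinner2025, Thm. 1.1.2 (a)] -/
theorem infinite_setOf_j_rankTwo_equalityDoor_at_five [Fact (Nat.Prime 5)]
    (hTZ : TaoZiegler2008_polynomialProgressions) (h85 : Schneider1985_order_charGenerator)
    (hMC : burungale_castella_skinner_charIdeal_eq_padicLFunction) :
    {j : ℚ | ∃ (W : WeierstrassCurve ℚ) (hW : W.IsElliptic) (_ : W.IsGloballyMinimal),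
      @WeierstrassCurve.j _ _ W hW = j ∧ W.mordellWeilRank = 2 ∧ W.HasGoodReductionAtPrime 5 ∧
      ¬ ((5 : ℕ) : ℤ) ∣ W.frobeniusTrace 5 ∧ W.HasIrreducibleModPGaloisRep 5 ∧
      ∀ {N : ℕ} [NeZero N] (f : CuspForm (Gamma0 N) 2), IsNewformOf W f →
        ((padicLFunction f (unitRoot W 5 : ℚ_[5])).order = 2 ↔
          Finite (AddCommGroup.primaryComponent W.sha 5))}.Infinite := by
  let F : ℕ × ℕ → ℚ := fun q =>
    if hq : ZywinaAdmissible q.1 q.2 then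
      @WeierstrassCurve.j _ _ (zywinaCurve q.1 q.2) (isElliptic_zywinaCurve hq) else 0
  have hinj : Set.InjOn F (zywinaClass 5 2 11 7) := by
    rintro ⟨m, n⟩ h₁ ⟨m', n'⟩ h₂ he
    have h₁' : ZywinaAdmissible m n := h₁.1
    have h₂' : ZywinaAdmissible m' n' := h₂.1
    simp only [F, dif_pos h₁', dif_pos h₂'] at he
    obtain ⟨rfl, rfl⟩ := eq_of_j_eq h₁' h₂' he
    rfl
  refine Set.infinite_of_injOn_mapsTo hinj ?_ (zywinaClass_five_two_eleven_seven_infinite hTZ)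
  rintro ⟨m, n⟩ hq
  have hq' : ZywinaAdmissible m n := hq.1
  haveI := isElliptic_zywinaCurve hq'
  haveI := isGloballyMinimal_zywinaCurve hq'
  obtain ⟨hgood, hord⟩ := goodOrdinary_five_zywinaCurve hq'
  exact ⟨zywinaCurve m n, isElliptic_zywinaCurve hq', isGloballyMinimal_zywinaCurve hq',
    by simp only [F, dif_pos hq'], mordellWeilRank_zywinaCurve hq', hgood, hord,
    hasIrreducibleModPGaloisRep_five_zywinaCurve hq' (seven_dvd_of_mem_zywinaClass (dvd_refl 7) hq),
    fun f hf ↦ equalityDoor_five_of_mem_zywinaClass h85 hMC (K := 2) (m₁ := 11) (M := 7) (by norm_num)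
      (by norm_num) (by decide) (dvd_refl 7) hq hf⟩

end Infinite

/-! ## §3 Consequences for the crux T = `FiniteShaComponentTransfer` -/

section Transfer

/-- **T PREDICTS `5`-adic BSD-rank on the class.** Granting T (`FiniteShaComponentTransfer`) and the two prints:
for every member of `zywinaClass 5 K m₁ M` (`7 ∣ M`, …) `ord_{T=0} L_5(E_{m,n}, T) = 2` — since `t_2(E_{m,n}) = 0`
is Zywina's theorem (`shaCorank_two_zywinaCurve`), T gives `t_5 = 0`, and the door converts it. A member with
`ord_{T=0} L_5 ≥ 3` would REFUTE T. CONDITIONAL on `hT`, `h85`, `hMC`. [cite: Zywina2025, Thm 1.2]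
[cite: BalakrishnanMullerStein2015, Thm. 1.7] [cite: BurungaleCastellaSkinner2025, Thm. 1.1.2 (a)] -/
theorem order_eq_two_of_transfer_of_mem_zywinaClass [Fact (Nat.Prime 5)] (hT : FiniteShaComponentTransfer)
    (h85 : Schneider1985_order_charGenerator) (hMC : burungale_castella_skinner_charIdeal_eq_padicLFunction)
    {K m₁ M : ℕ} (hK : 0 < K) (h5m₁ : ¬ 5 ∣ m₁) (hμ : ¬ (5 : ℤ) ^ K ∣ (m₁ : ℤ) ^ (5 - 1) - 1) (h7M : 7 ∣ M)
    (hmn : (m, n) ∈ zywinaClass 5 K m₁ M) [(zywinaCurve m n).IsElliptic] [(zywinaCurve m n).IsGloballyMinimal]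
    {N : ℕ} [NeZero N] {f : CuspForm (Gamma0 N) 2} (hf : IsNewformOf (zywinaCurve m n) f) :
    (padicLFunction f (unitRoot (zywinaCurve m n) 5 : ℚ_[5])).order = 2 :=
  order_eq_two_of_transfer_zywinaCurve hT h85 hMC hmn.1 (seven_dvd_of_mem_zywinaClass h7M hmn)
    (schneiderConjecture_five_of_mem_zywinaClass hK h5m₁ hμ hmn) hf

/-- **T's instance `(E_{m,n}, 2, 5)` IS the `5`-adic BSD-rank statement**, on the class and granting the two
prints: `(t_2(E_{m,n}) = 0 → t_5(E_{m,n}) = 0) ⟺ ord_{T=0} L_5(E_{m,n}, T) = 2` — the converse that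
`crossPrimeRow_zywinaCurve_iff_order_eq_two` lacked, and without Kato's rank bound. CONDITIONAL on `h85`, `hMC`.
[cite: Zywina2025, Thm 1.2] [cite: BalakrishnanMullerStein2015, Thm. 1.7] [cite: BurungaleCastellaSkinner2025, Thm. 1.1.2 (a)] -/
theorem transfer_instance_iff_order_eq_two_of_mem_zywinaClass [Fact (Nat.Prime 5)] [Fact (Nat.Prime 2)]
    (h85 : Schneider1985_order_charGenerator) (hMC : burungale_castella_skinner_charIdeal_eq_padicLFunction)
    {K m₁ M : ℕ} (hK : 0 < K) (h5m₁ : ¬ 5 ∣ m₁) (hμ : ¬ (5 : ℤ) ^ K ∣ (m₁ : ℤ) ^ (5 - 1) - 1) (h7M : 7 ∣ M)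
    (hmn : (m, n) ∈ zywinaClass 5 K m₁ M) [(zywinaCurve m n).IsElliptic] [(zywinaCurve m n).IsGloballyMinimal]
    {N : ℕ} [NeZero N] {f : CuspForm (Gamma0 N) 2} (hf : IsNewformOf (zywinaCurve m n) f) :
    ((zywinaCurve m n).shaCorank 2 = 0 → (zywinaCurve m n).shaCorank 5 = 0) ↔
      (padicLFunction f (unitRoot (zywinaCurve m n) 5 : ℚ_[5])).order = 2 :=
  transfer_instance_iff_order_eq_two h85 hMC hmn.1 (seven_dvd_of_mem_zywinaClass h7M hmn)
    (schneiderConjecture_five_of_mem_zywinaClass hK h5m₁ hμ hmn) hf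

end Transfer

end Classes

/-! ## §4 Discharging `hInf` of `…ZywinaEqualityDoorInfinite` (p762756) from Tao–Ziegler -/

section DischargeInf

open Summit.BirchSwinnertonDyer.BirchSwinnertonDyer.Theorems.ShaPrimaryTransferZywinaEqualityDoorInfinite

/-- The admissible pairs with `7 ∣ n` are infinite, modulo Tao–Ziegler (`L = 1`, `d = 7` in
`infinite_setOf_zywinaAdmissible_modEq_dvd`). [cite: Zywina2025, §4 (proof of Thm 1.1, first paragraph)] -/
theorem infinite_admissible_seven (hTZ : TaoZiegler2008_polynomialProgressions) :
    {mn : ℕ × ℕ | ZywinaAdmissible mn.1 mn.2 ∧ 7 ∣ mn.2}.Infinite :=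
  (infinite_setOf_zywinaAdmissible_modEq_dvd hTZ (L := 1) (d := 7) (m₁ := 11) one_pos (by norm_num) rfl
      (Nat.coprime_one_right 11)).mono fun _ h ↦ ⟨h.1, h.2.2⟩

-- Consumers: `infinite_setOf_j_rankTwo_goodOrdinary_irreducible_five (infinite_admissible_seven hTZ)`,
-- `infinite_setOf_j_rankTwo_asymmetricDoor_five (infinite_admissible_seven hTZ) h85 hMC` (p762756).

end DischargeInf

end Summit.BirchSwinnertonDyer.BirchSwinnertonDyer.Theorems.ShaPrimaryTransferZywinaEqualityDoorClasses
end
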